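import Summits.HodgeConjecture.CorCM.Census.CyclicFacesResidue

/-!
# Boundary sets of cyclic CM types, V: `β − 1` face orbits generate the Hodge lattice of a cyclic CM type modulo pairs

COR-CM (cell `pub-hodgecm2`), count-neutral kernel combinatorics by the binder seat b23 (gen 38; lane CYCLIC-FACES, part V, the assembly of
`Census/CyclicBoundaryWindows` / `…Slide` / `…Descent` (parts I–II), `Census/CyclicTypeBoundary` (III), `Census/CyclicFacesResidue` (IV)).  Theorems
only, in seat b09's intrinsic model (`CMF G c`, `rt`, `oflipCM`, `gface`/`gfaceSet`, `pair`/`pairSet`, `translates`, `hodgeSpan`, `Block`/`blk`,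
`fibreTwo`: `Census/BlockParity*.lean`, `Census/Coinvariant*.lean` — consumed BY NAME, nothing restated); no certificate, no `decide`
table, no named fact, no geometry, no `sorry`.
HONEST FRAMING: `HC_CM` is NOT proved, here or anywhere in the tree; nothing here is a period or a headline.

MAIN THEOREM (**`exists_gfaces_generate_of_isCyclic`**, **`exists_gfaces_generate_of_isCyclic_card_eq`**).  For a finite CYCLIC group `G`
and an involution `c ≠ 1` of `G`: there is a finite set `S ⊆ gfaceSet G c` of face relations with
  `|S| + 1 = β(G, c) = #Block c`  and  `hodgeSpan c ≤ ℤ⟨pairs⟩ + ℤ⟨all base changes of S⟩`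
— the integer Hodge vectors of the cyclic Galois CM type `(G, c)` are generated, MODULO PAIRS AND INTEGRALLY (index `1`), by the Galois
translates of `β − 1` rank-four face relations; and by seat b09's coinvariant floor (`Coinvariant.fibreTwo_le_card_of_faces`,
`Coinvariant.fibreTwo_add_one_eq_card_block_of_isCyclic`) no family of fewer faces generates: **`μ(G, c) = β(G, c) − 1 = φ₂(G, c)`** for
EVERY cyclic Galois CM type, both parities of `|G|/2`, with `β·|G| = Σ_{d ∣ |G|, d odd} φ(d)·2^{|G|/2d}`
(`BlockParity.card_block_mul_card_of_isCyclic`).  The twisted case `4 ∣ |G|` (`c ∈ G²`; censused only at `ℤ/8 1 · ℤ/12 5 · ℤ/16 15 ·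
ℤ/20 51 · ℤ/24 171`) is new; `|G| ≡ 2 (mod 4)` re-proves the odd-slice count `#OrbitsA` (`Census/OddSliceFaces*`) in intrinsic dress.

PROOF (§1–§2).  Along a generator `g` (`gⁿ = c`, part III's boundary sets `bd`): choose one potential-lowering face relation through the
representative `B.out` of every block `B` of types with non-singleton boundary sets (part IV `exists_gface`); their base changes give such
a relation through EVERY non-singleton type (`pot_bd_rt`, `rt_oflipCM`, `mapDomain_rt_gface`), so part IV's `descent` + residue put every
Hodge vector in `ℤ⟨pairs⟩ + ℤ⟨translates⟩`; the singleton-boundary types fill at least one block (`exists_card_bd_eq_one`), whence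
`|S| + 1 ≤ β`, and the floor gives `≥`.  §3 packages the generator of a cyclic group with its unique involution
(`exists_generator_data`).  All [folklore] bookkeeping over [Pohlmann1968, Thm 1] in the reading of [Milne1999, Prop. 2.1].

## References
* [Pohlmann1968] H. Pohlmann, Algebraic cycles on abelian varieties of complex multiplication type, Ann. of Math. 88 (1968), Thm 1.
* [Milne1999] J. S. Milne, Lefschetz motives and the Tate conjecture, Compositio Math. 117 (1999), Prop. 2.1, p. 54.
-/

namespace Summit.HodgeConjecture.CorCM.Census.CyclicFaces

open Finset
open scoped symmDiff
open Summit.HodgeConjecture.CorCM.Prior.AllgGroup.RfwfAllgGroup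
open Summit.HodgeConjecture.CorCM.Census.BlockParity
open Summit.HodgeConjecture.CorCM.Census.Coinvariant
open Summit.HodgeConjecture.CorCM.Census.CyclicBoundary

noncomputable section

variable {G : Type*} [Group G] [Fintype G] [DecidableEq G] (c : G) (g : G) {n : ℕ}

/-! ## §1 Blocks of singleton / non-singleton boundary types -/

section Generator

variable [NeZero n]

/-- The representative of the block of `Ψ` has a boundary set of the same size as `Ψ`. [folklore] -/
theorem card_bd_out (hgn : g ^ n = c) (hgen : ∀ x : G, x ∈ Submonoid.powers g) (Ψ : CMF G c) :
    (bd c g n (blk c Ψ).out).card = (bd c g n Ψ).card := by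
  have h : blk c (blk c Ψ).out = blk c Ψ := Quotient.out_eq _
  obtain ⟨Q, hQ⟩ := exists_rt_eq_of_blk_eq c h.symm
  rw [← hQ, card_bd_rt c g hgn hgen]

/-- Base changes of face relations are face relations. [folklore] -/
theorem mapDomain_rt_mem_gfaceSet (hc2 : c * c = 1) (Q : G) {Φ : CMF G c} {t t' : G} (ht' : t' ∉ orb c t) :
    Finsupp.mapDomain (rt c Q) (gface c hc2 Φ t t') ∈ gfaceSet G c hc2 := by
  rw [mapDomain_rt_gface]
  refine ⟨rt c Q Φ, t * Q⁻¹, t' * Q⁻¹, fun h => ht' ?_, rfl⟩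
  rw [← mul_mem_orb_iff] at h
  rwa [inv_mul_cancel_right] at h

/-! ## §2 The family and the main theorem along a generator -/

/-- **MAIN THEOREM along a generator.**  `G = ⟨g⟩` of order `2n`, `c = gⁿ`: there is `S ⊆ gfaceSet` with `|S| + 1 ≤ #Block c` whose base
changes generate `hodgeSpan` modulo pairs. [folklore] -/
theorem exists_gfaces_generate_gen (hc2 : c * c = 1) (hc1 : c ≠ 1) (hgn : g ^ n = c) (hord : orderOf g = 2 * n)
    (hgen : ∀ x : G, x ∈ Submonoid.powers g) :
    ∃ S : Finset (CMF G c →₀ ℤ), (↑S ⊆ gfaceSet G c hc2) ∧ S.card + 1 ≤ Fintype.card (Block c) ∧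
      hodgeSpan c hc2 ≤ Submodule.span ℤ (pairSet c) ⊔ Submodule.span ℤ (translates c S) := by
  classical
  have hcen := hcen_of_gen c g hgn hgen
  -- one potential-lowering face relation through the representative of every non-singleton block
  have hch : ∀ B : Block c, ∃ τ : G × G, (bd c g n B.out).card ≠ 1 →
      τ.2 ∉ orb c τ.1 ∧ pot (bd c g n (oflipCM c hc2 τ.1 B.out)) < pot (bd c g n B.out) ∧
        pot (bd c g n (oflipCM c hc2 τ.2 B.out)) < pot (bd c g n B.out) ∧
        pot (bd c g n (oflipCM c hc2 τ.1 (oflipCM c hc2 τ.2 B.out))) < pot (bd c g n B.out) := by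
    intro B
    by_cases h1 : (bd c g n B.out).card = 1
    · exact ⟨(1, 1), fun h => absurd h1 h⟩
    · obtain ⟨t, t', ht', h₁, h₂, h₃⟩ := exists_gface c g hc2 hgn hord B.out h1
      exact ⟨(t, t'), fun _ => ⟨ht', h₁, h₂, h₃⟩⟩
  choose τ hτ using hch
  set NI : Finset (Block c) := Finset.univ.filter fun B => (bd c g n B.out).card ≠ 1 with hNI
  set S : Finset (CMF G c →₀ ℤ) := NI.image fun B => gface c hc2 B.out (τ B).1 (τ B).2 with hS
  have hSsub : (↑S : Set (CMF G c →₀ ℤ)) ⊆ gfaceSet G c hc2 := by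
    intro y hy
    obtain ⟨B, hB, rfl⟩ := Finset.mem_image.mp (Finset.mem_coe.mp hy)
    exact ⟨B.out, (τ B).1, (τ B).2, (hτ B (Finset.mem_filter.mp hB).2).1, rfl⟩
  set L : Submodule ℤ (CMF G c →₀ ℤ) := Submodule.span ℤ (pairSet c) ⊔ Submodule.span ℤ (translates c S) with hL
  refine ⟨S, hSsub, ?_, ?_⟩
  · -- the singleton-boundary types fill at least one block
    obtain ⟨Ψ₁, hΨ₁⟩ := exists_card_bd_eq_one c g hc2 hc1 hgn hord
    have hB₁ : blk c Ψ₁ ∉ NI := by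
      intro h
      exact (Finset.mem_filter.mp h).2 (by rw [card_bd_out c g hgn hgen, hΨ₁])
    have hsub : NI ⊆ Finset.univ.erase (blk c Ψ₁) := fun B hB =>
      Finset.mem_erase.mpr ⟨fun h => hB₁ (h ▸ hB), Finset.mem_univ B⟩
    have h1 := Finset.card_le_card hsub
    rw [Finset.card_erase_of_mem (Finset.mem_univ _), Finset.card_univ] at h1
    have h2 : S.card ≤ NI.card := Finset.card_image_le
    have h3 : 0 < Fintype.card (Block c) := Fintype.card_pos_iff.mpr ⟨blk c Ψ₁⟩
    omega
  · -- generation: `L` holds a potential-lowering relation through every non-singleton type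
    have hLface : ∀ Ψ : CMF G c, (bd c g n Ψ).card ≠ 1 → ∃ t t' : G, gface c hc2 Ψ t t' ∈ L ∧
        pot (bd c g n (oflipCM c hc2 t Ψ)) < pot (bd c g n Ψ) ∧ pot (bd c g n (oflipCM c hc2 t' Ψ)) < pot (bd c g n Ψ) ∧
        pot (bd c g n (oflipCM c hc2 t (oflipCM c hc2 t' Ψ))) < pot (bd c g n Ψ) := by
      intro Ψ hΨ
      set B := blk c Ψ with hB
      have hBNI : B ∈ NI := Finset.mem_filter.mpr ⟨Finset.mem_univ _, by rw [hB, card_bd_out c g hgn hgen]; exact hΨ⟩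
      obtain ⟨ht', h₁, h₂, h₃⟩ := hτ B (Finset.mem_filter.mp hBNI).2
      obtain ⟨Q, hQ⟩ := exists_rt_eq_of_blk_eq c (Quotient.out_eq B : blk c B.out = blk c Ψ)
      refine ⟨(τ B).1 * Q⁻¹, (τ B).2 * Q⁻¹, ?_, ?_, ?_, ?_⟩
      · have e : gface c hc2 Ψ ((τ B).1 * Q⁻¹) ((τ B).2 * Q⁻¹) =
            Finsupp.mapDomain (rt c Q) (gface c hc2 B.out (τ B).1 (τ B).2) := by rw [mapDomain_rt_gface, hQ]
        rw [e]
        exact Submodule.mem_sup_right (Submodule.subset_span ⟨Q, _, Finset.mem_image_of_mem _ hBNI, rfl⟩)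
      · rw [← hQ, ← rt_oflipCM, pot_bd_rt c g hgn hgen, pot_bd_rt c g hgn hgen]; exact h₁
      · rw [← hQ, ← rt_oflipCM, pot_bd_rt c g hgn hgen, pot_bd_rt c g hgn hgen]; exact h₂
      · rw [← hQ, ← rt_oflipCM, ← rt_oflipCM, pot_bd_rt c g hgn hgen, pot_bd_rt c g hgn hgen]; exact h₃
    have hLle : L ≤ hodgeSpan c hc2 := by
      refine sup_le (Submodule.span_le.mpr fun y hy => ?_) (Submodule.span_le.mpr fun y hy => ?_)
      · obtain ⟨Ψ, rfl⟩ := hy; exact pair_mem_hodgeSpan c hc2 Ψ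
      · obtain ⟨Q, s, hs, rfl⟩ := hy
        obtain ⟨Φ, t, t', ht', rfl⟩ := hSsub hs
        exact gfaceSet_subset_hodgeSpan c hc2 (mapDomain_rt_mem_gfaceSet c hc2 Q ht')
    intro y hy
    obtain ⟨y', hyy', hy'⟩ := descent c g hc2 L hLface y
    have hy'H : y' ∈ hodgeSpan c hc2 := by
      have e : y' = y - (y - y') := by abel
      rw [e]; exact Submodule.sub_mem _ hy (hLle hyy')
    have hres := mem_span_pairSet_of_card_bd_eq_one c g hgn hgen y'
      (exists_forall_typeSum_eq_of_mem_hodgeSpan c hc2 hcen hy'H) hy'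
    have e : y = (y - y') + y' := by abel
    rw [e]
    exact Submodule.add_mem _ hyy' (Submodule.mem_sup_left hres)

end Generator

/-! ## §3 Cyclic groups: the generator and the unique involution -/

omit [DecidableEq G] in
/-- **In a finite cyclic group with an involution `c ≠ 1`** there is a generator `g` of order `2n` with `gⁿ = c`. [folklore] -/
theorem exists_generator_data [IsCyclic G] (hc2 : c * c = 1) (hc1 : c ≠ 1) :
    ∃ (g : G) (n : ℕ), 0 < n ∧ g ^ n = c ∧ orderOf g = 2 * n ∧ ∀ x : G, x ∈ Submonoid.powers g := by
  classical
  obtain ⟨g, hg⟩ := IsCyclic.exists_generator (α := G)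
  have hgen : ∀ x : G, x ∈ Submonoid.powers g := fun x => mem_powers_iff_mem_zpowers.mpr (hg x)
  have hog : orderOf g = Fintype.card G := by rw [← Nat.card_eq_fintype_card]; exact orderOf_eq_card_of_forall_mem_zpowers hg
  have hoc : orderOf c = 2 := orderOf_eq_prime (by rw [pow_two]; exact hc2) hc1
  have h2 : 2 ∣ Fintype.card G := by rw [← hoc]; exact orderOf_dvd_card
  obtain ⟨n, hn⟩ := h2
  have hnpos : 0 < n := by
    have := Fintype.card_pos_iff.mpr ⟨c⟩
    omega
  have hord : orderOf g = 2 * n := by rw [hog, hn]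
  refine ⟨g, n, hnpos, ?_, hord, hgen⟩
  -- `gⁿ` is an involution, and the involution of a cyclic group is unique
  have hx2 : orderOf (g ^ n) = 2 := by
    refine orderOf_eq_prime ?_ ?_
    · rw [← pow_mul, show n * 2 = 2 * n from by ring, ← hord]; exact pow_orderOf_eq_one g
    · exact pow_ne_one_of_lt_orderOf hnpos.ne' (by omega)
  have hcard := IsCyclic.card_orderOf_eq_totient (α := G) (show 2 ∣ Fintype.card G from ⟨n, hn⟩)
  rw [Nat.totient_two, Finset.card_eq_one] at hcard
  obtain ⟨a, ha⟩ := hcard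
  have hmem : ∀ x : G, orderOf x = 2 → x = a := by
    intro x hx
    have : x ∈ ({a} : Finset G) := by rw [← ha]; simp [hx]
    simpa using this
  rw [hmem _ hx2, hmem _ hoc]

/-- **MAIN THEOREM (cyclic group form).**  For a finite cyclic group `G` and an involution `c ≠ 1`: there is `S ⊆ gfaceSet G c` with
`|S| + 1 ≤ β(G, c)` whose base changes generate `hodgeSpan c` modulo pairs. [folklore] -/
theorem exists_gfaces_generate_of_isCyclic [IsCyclic G] (hc2 : c * c = 1) (hc1 : c ≠ 1) :
    ∃ S : Finset (CMF G c →₀ ℤ), (↑S ⊆ gfaceSet G c hc2) ∧ S.card + 1 ≤ Fintype.card (Block c) ∧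
      hodgeSpan c hc2 ≤ Submodule.span ℤ (pairSet c) ⊔ Submodule.span ℤ (translates c S) := by
  obtain ⟨g, n, hn, hgn, hord, hgen⟩ := exists_generator_data c hc2 hc1
  haveI : NeZero n := ⟨hn.ne'⟩
  exact exists_gfaces_generate_gen c g hc2 hc1 hgn hord hgen

/-- **MAIN THEOREM with the exact count** (`μ = β − 1 = φ₂`): together with seat b09's coinvariant floor the family has EXACTLY `β − 1`
members, and no family of fewer faces generates. [folklore] -/
theorem exists_gfaces_generate_of_isCyclic_card_eq [IsCyclic G] (hc2 : c * c = 1) (hc1 : c ≠ 1) :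
    ∃ S : Finset (CMF G c →₀ ℤ), (↑S ⊆ gfaceSet G c hc2) ∧ S.card + 1 = Fintype.card (Block c) ∧ fibreTwo c hc2 = S.card ∧
      hodgeSpan c hc2 ≤ Submodule.span ℤ (pairSet c) ⊔ Submodule.span ℤ (translates c S) := by
  obtain ⟨S, hS, hcard, hgenr⟩ := exists_gfaces_generate_of_isCyclic c hc2 hc1
  have hfloor := fibreTwo_le_card_of_faces c hc2 (mul_comm_of_isCyclic c) S hS
    (fun y hy => hgenr (gfaceSet_subset_hodgeSpan c hc2 hy))
  have hβ := fibreTwo_add_one_eq_card_block_of_isCyclic c hc2 hc1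
  exact ⟨S, hS, by omega, by omega, hgenr⟩

/-- **The face form**: the face relations themselves lie in `ℤ⟨pairs⟩ + ℤ⟨translates of S⟩` (the hypothesis shape of b09's floors).
[folklore] -/
theorem exists_gfaceSet_subset_of_isCyclic [IsCyclic G] (hc2 : c * c = 1) (hc1 : c ≠ 1) :
    ∃ S : Finset (CMF G c →₀ ℤ), (↑S ⊆ gfaceSet G c hc2) ∧ S.card + 1 = Fintype.card (Block c) ∧
      gfaceSet G c hc2 ⊆ ↑(Submodule.span ℤ (pairSet c) ⊔ Submodule.span ℤ (translates c S)) := by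
  obtain ⟨S, hS, hcard, -, hgenr⟩ := exists_gfaces_generate_of_isCyclic_card_eq c hc2 hc1
  exact ⟨S, hS, hcard, fun y hy => hgenr (gfaceSet_subset_hodgeSpan c hc2 hy)⟩

end

end Summit.HodgeConjecture.CorCM.Census.CyclicFaces
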